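import Mathlib
import Summits.ValiantsHypothesis.ValiantsHypothesis.Theorems.LiouvilleSarnakLiouvilleCutRankCertifiedCutPoints
import HarnessLib

/-!
# Route LiouvilleSarnak — crux `LiouvilleCutRank` (stmt-ValiantsHypothesis-14775):
# an EXPLICIT rank bound for the bit-interleaving cut: `rank M_π ≥ ⌊log₂ n⌋` at every level `n`

`Theorems/LiouvilleSarnakLiouvilleCutRankInterleavedUnbounded.lean` proved that the cut matrices of the
bit-interleaving cuts `(CR)^n` have unbounded rank, without a rate.  Using the finite certificate criterion
`…CertifiedCutPoints.card_le_two_pow_rank_of_certified` this file gives the explicit bound `n ≤ 2^{rank M_π}` at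
EVERY level `n`: the `n` even cut points `p = 2s` (`s < n`) are pairwise certified by `c = 3` — between `2s` and
`2t` the row positions are the odd ones, `m = Σ_{i<t-s} 2^{2i+1} = 2x` with `x = Σ_{i<t-s} 4^i`, and the bits of
`x - 1 = Σ_{1 ≤ i < t-s} 4^i` sit at the even (= column) positions `2s + 2i`.

* `geom4_testBit` — the bits of `Σ_{i<k} 4^i` are exactly the even positions `< 2k`.
* ★ `le_two_pow_rank_interleaved` — `n ≤ 2^{rank M_π}` for the bit-interleaving cut at level `n`;
  `log_le_rank_interleaved` — `Nat.log 2 n ≤ rank M_π`.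

Honest framing: a quantitative rung for one cut family; the crux `LiouvilleCutRank`, `DigitalBilinearLiouville`,
`AlgebraicSarnak` stay OPEN; nothing bears on `VP ≠ VNP`.  No definitions.
-/

set_option linter.dupNamespace false

noncomputable section

namespace Summit.ValiantsHypothesis.ValiantsHypothesis.Theorems.LiouvilleSarnakLiouvilleCutRank.InterleavedQuantitative

open ArithmeticFunction Finset

open Summit.ValiantsHypothesis.ValiantsHypothesis.Theorems.LiouvilleSarnakLiouvilleCutRank.CertifiedCutPoints
  (card_le_two_pow_rank_of_certified)

/-! ### §1 Bits of `Σ_{i<k} 4^i` -/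

/-- `Σ_{i<k+1} 4^i = 4 · (Σ_{i<k} 4^i) + 1`. [folklore] -/
theorem geom4_succ (k : ℕ) : (∑ i ∈ Finset.range (k + 1), 4 ^ i) = 2 ^ 2 * (∑ i ∈ Finset.range k, 4 ^ i) + 1 := by
  rw [Finset.sum_range_succ', Finset.mul_sum, pow_zero]
  congr 1
  refine Finset.sum_congr rfl fun i _ => ?_
  rw [pow_succ]
  ring

/-- The bits of `Σ_{i<k} 4^i` are exactly the even positions below `2k`. [folklore] -/
theorem geom4_testBit : ∀ (k b : ℕ), (∑ i ∈ Finset.range k, 4 ^ i).testBit b = (decide (b % 2 = 0) && decide (b < 2 * k)) := by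
  intro k
  induction k with
  | zero => intro b; simp
  | succ k ih =>
    intro b
    rw [geom4_succ, Nat.testBit_two_pow_mul_add _ (by norm_num : 1 < 2 ^ 2)]
    by_cases hb : b < 2
    · rw [if_pos hb]
      interval_cases b
      · simp
      · simp
        decide
    · rw [if_neg hb, ih]
      have h1 : (b - 2) % 2 = b % 2 := by omega
      rw [h1]
      by_cases hpar : b % 2 = 0 <;> by_cases hlt : b < 2 * (k + 1) <;> simp [hpar, hlt] <;> omega

/-! ### §2 The explicit bound -/

/-- ★ **`n ≤ 2^{rank}` for the bit-interleaving cut.**  At every level `n`, the cut matrix of the bit-interleaving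
cut (row bit `i` at position `2i+1`, column bit `i` at position `2i`) has `n ≤ 2^{rank M_π}`: the even cut points
`2s`, `s < n`, are pairwise certified with `c = 3`. [this file] -/
theorem le_two_pow_rank_interleaved (n : ℕ) (π : Fin n ⊕ Fin n ≃ Fin (2 * n))
    (hπ : ∀ i : Fin n, (π (Sum.inl i) : ℕ) = 2 * i + 1 ∧ (π (Sum.inr i) : ℕ) = 2 * i) :
    n ≤ 2 ^ (Matrix.of fun r c : Fin n → Bool =>
      (((liouville (Nat.ofBits (fun k : Fin (2 * n) => Sum.elim r c (π.symm k)) + 1) : ℤ) : ℂ))).rank := by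
  classical
  have h3 : liouville 3 = -1 := by
    rw [liouville_apply (by norm_num : (3 : ℕ) ≠ 0), cardFactors_apply_prime Nat.prime_three]; norm_num
  -- positions: `π.symm j` is a row iff `j` is odd
  have hleft : ∀ j : Fin (2 * n), (π.symm j).isLeft = true ↔ (j : ℕ) % 2 = 1 := by
    intro j
    rcases hj : π.symm j with i | i
    · have hji : (π (Sum.inl i) : ℕ) = j := by rw [← hj, Equiv.apply_symm_apply]
      rw [(hπ i).1] at hji
      simp only [Sum.isLeft_inl, true_iff]
      omega
    · have hji : (π (Sum.inr i) : ℕ) = j := by rw [← hj, Equiv.apply_symm_apply]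
      rw [(hπ i).2] at hji
      simp only [Sum.isLeft_inr, Bool.false_eq_true, false_iff]
      omega
  -- the row-position sum between `2s` and `2t`
  have hsum : ∀ s t : ℕ, s < t → t ≤ n →
      (∑ j : Fin (2 * n), if 2 * s ≤ (j : ℕ) ∧ (j : ℕ) < 2 * t ∧ (π.symm j).isLeft = true
        then 2 ^ ((j : ℕ) - 2 * s) else 0) = (∑ i ∈ Finset.range (t - s), 4 ^ i) * (3 - 1) := by
    intro s t hst htn
    -- rewrite the indicator through `hleft` and pass to a sum over `range (2n)`
    have h1 : (∑ j : Fin (2 * n), if 2 * s ≤ (j : ℕ) ∧ (j : ℕ) < 2 * t ∧ (π.symm j).isLeft = true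
        then 2 ^ ((j : ℕ) - 2 * s) else 0) =
        ∑ j ∈ Finset.range (2 * n), if 2 * s ≤ j ∧ j < 2 * t ∧ j % 2 = 1 then 2 ^ (j - 2 * s) else 0 := by
      rw [← Fin.sum_univ_eq_sum_range (fun j => if 2 * s ≤ j ∧ j < 2 * t ∧ j % 2 = 1 then 2 ^ (j - 2 * s) else 0)]
      refine Finset.sum_congr rfl fun j _ => ?_
      simp only [hleft j]
    rw [h1]
    -- only the odd `j = 2s + 2i + 1`, `i < t - s`, contribute
    rw [show (∑ i ∈ Finset.range (t - s), 4 ^ i) * (3 - 1) = ∑ i ∈ Finset.range (t - s), 2 ^ (2 * i + 1) from by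
      rw [Finset.sum_mul]
      refine Finset.sum_congr rfl fun i _ => ?_
      rw [pow_succ, pow_mul]; norm_num]
    -- reindex: i ↦ j = 2s + 2i + 1 onto the support
    symm
    refine Finset.sum_bij_ne_zero (fun i _ _ => 2 * s + 2 * i + 1) (fun i hi _ => ?_)
      (fun i₁ _ _ i₂ _ _ h => by omega) (fun j hj hne => ?_) (fun i hi _ => ?_)
    · rw [Finset.mem_range] at hi ⊢; omega
    · rw [Finset.mem_range] at hj
      by_cases hc : 2 * s ≤ j ∧ j < 2 * t ∧ j % 2 = 1
      · exact ⟨(j - 2 * s - 1) / 2, Finset.mem_range.mpr (by omega), by positivity, by omega⟩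
      · exact absurd (if_neg hc) hne
    · rw [Finset.mem_range] at hi
      rw [if_pos ⟨by omega, by omega, by omega⟩]
      congr 1
      omega
  -- apply the certificate criterion with `P = {0, 2, …, 2(n-1)}`
  have key := card_le_two_pow_rank_of_certified n π ((Finset.range n).image fun s => 2 * s)
    (fun p hp => by
      obtain ⟨s, hs, rfl⟩ := Finset.mem_image.mp hp
      rw [Finset.mem_range] at hs; omega)
    (fun p hp p' hp' hpp' => by
      obtain ⟨s, hs, rfl⟩ := Finset.mem_image.mp hp
      obtain ⟨t, ht, rfl⟩ := Finset.mem_image.mp hp'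
      rw [Finset.mem_range] at hs ht
      have hst : s < t := by omega
      refine ⟨3, ∑ i ∈ Finset.range (t - s), 4 ^ i, h3, ?_, (hsum s t hst ht.le).symm, ?_⟩
      · -- `x ≥ 1`: the term `i = 0`
        have : 1 ≤ t - s := by omega
        calc 1 = ∑ i ∈ Finset.range 1, 4 ^ i := by simp
          _ ≤ ∑ i ∈ Finset.range (t - s), 4 ^ i :=
            Finset.sum_le_sum_of_subset (Finset.range_subset_range.mpr this)
      · -- bits of `x - 1 = 4 · Σ_{i < t-s-1} 4^i` are at even positions `2 ≤ b < 2(t-s)`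
        intro b hb
        obtain ⟨k, hk⟩ : ∃ k, t - s = k + 1 := ⟨t - s - 1, by omega⟩
        rw [hk, geom4_succ, Nat.add_sub_cancel, Nat.testBit_two_pow_mul] at hb
        simp only [Bool.and_eq_true, decide_eq_true_eq] at hb
        obtain ⟨hb2, hb'⟩ := hb
        rw [geom4_testBit] at hb'
        simp only [Bool.and_eq_true, decide_eq_true_eq] at hb'
        obtain ⟨hpar, hlt⟩ := hb'
        refine ⟨⟨s + b / 2, by omega⟩, ?_⟩
        rw [(hπ _).2]
        simp only
        omega)
  rwa [Finset.card_image_of_injective _ (fun a b h => by simpa using h), Finset.card_range] at key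

/-- `⌊log₂ n⌋ ≤ rank M_π` for the bit-interleaving cut at level `n`. [this file] -/
theorem log_le_rank_interleaved (n : ℕ) (π : Fin n ⊕ Fin n ≃ Fin (2 * n))
    (hπ : ∀ i : Fin n, (π (Sum.inl i) : ℕ) = 2 * i + 1 ∧ (π (Sum.inr i) : ℕ) = 2 * i) :
    Nat.log 2 n ≤ (Matrix.of fun r c : Fin n → Bool =>
      (((liouville (Nat.ofBits (fun k : Fin (2 * n) => Sum.elim r c (π.symm k)) + 1) : ℤ) : ℂ))).rank := by
  have h := le_two_pow_rank_interleaved n π hπ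
  calc Nat.log 2 n ≤ Nat.log 2 (2 ^ _) := Nat.log_mono_right h
    _ = _ := Nat.log_pow (by norm_num) _

end Summit.ValiantsHypothesis.ValiantsHypothesis.Theorems.LiouvilleSarnakLiouvilleCutRank.InterleavedQuantitative

end
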